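import Summits.HodgeConjecture.HodgeCM.PerL34.FockStoneHamiltonian_1

/-! PORT of `HodgeCM/PerL34/FockStoneHamiltonian.lean` (HodgeCMPerL run 82) — part 2: continuation of `Summits.HodgeConjecture.HodgeCM.PerL34.FockStoneHamiltonian_1` (split at a top-level declaration boundary by port_pkg.py; scope re-opened below; declarations unchanged). -/

-- port_pkg: scope re-opened for this part (file-level context, then the namespace/section stack open at the cut)
noncomputable section
namespace HodgeCM.PerL34.Fock.Hermite
open Complex Matrix Filter Topology
open scoped ComplexConjugate InnerProductSpace NNReal
open Literature.Analysis.UnboundedOperators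
attribute [local instance 10000] InnerProductSpace.toInner
variable {σ : Type*} [Fintype σ] [DecidableEq σ]
/-- **Stone's theorem (generator half) for the concrete group `t ↦ ν₀(e^{tX})`, `X ∈ 𝔲(σ)`**: its Hamiltonian
`H = −i·genOp` on `genDom` is SELF-ADJOINT in Mathlib's `LinearPMap` sense (`H† = H`).  Proof: `H ≤ H†` is the
symmetry above (`LinearPMap.IsFormalAdjoint.le_adjoint`); `H† ≤ H` is #9's skew-adjointness of `genOp`
(`mem_genDom_of_forall_inner_genDom` / `genOp_eq_of_forall_inner_genDom`). -/
theorem isSelfAdjoint_hamiltonian_fockGroup {X : Matrix σ σ ℂ} (hX : star X = -X) :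
    IsSelfAdjoint (fockGroup hX).hamiltonian := by
  rw [LinearPMap.isSelfAdjoint_def, hamiltonian_fockGroup]
  set T : FockL2 σ →ₗ.[ℂ] FockL2 σ := (-I) • genPMap hX with hT_def
  have hT : Dense (T.domain : Set (FockL2 σ)) := dense_genDom hX
  have hsymm : T.IsFormalAdjoint T := isFormalAdjoint_smul_genPMap hX
  refine le_antisymm ?_ (hsymm.le_adjoint hT)
  have hadj : T.adjoint.IsFormalAdjoint T := LinearPMap.adjoint_isFormalAdjoint hT
  have key : ∀ y : T.adjoint.domain, ∃ hy : (y : FockL2 σ) ∈ genDom hX, (-I) • genOp hX ⟨y, hy⟩ = T.adjoint y := by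
    intro y
    have h : ∀ v : genDom hX, ⟪genOp hX v, (y : FockL2 σ)⟫_ℂ + ⟪(v : FockL2 σ), I • T.adjoint y⟫_ℂ = 0 := by
      intro v
      have h1 : ⟪T.adjoint y, (v : FockL2 σ)⟫_ℂ = ⟪(y : FockL2 σ), (-I) • genOp hX v⟫_ℂ := by
        have h0 := hadj y ⟨v, v.2⟩
        rwa [LinearPMap.smul_apply] at h0
      rw [inner_smul_right (E := FockL2 σ)] at h1
      have e1 : ⟪genOp hX v, (y : FockL2 σ)⟫_ℂ = conj ⟪(y : FockL2 σ), genOp hX v⟫_ℂ := (inner_conj_symm _ _).symm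
      have e2 : ⟪(v : FockL2 σ), I • T.adjoint y⟫_ℂ = I * conj ⟪T.adjoint y, (v : FockL2 σ)⟫_ℂ := by
        rw [inner_smul_right (E := FockL2 σ), inner_conj_symm]
      rw [e1, e2, h1, map_mul, map_neg, Complex.conj_I, neg_neg, ← mul_assoc, Complex.I_mul_I, neg_one_mul,
        add_neg_cancel]
    exact ⟨mem_genDom_of_forall_inner_genDom hX h, by
      rw [genOp_eq_of_forall_inner_genDom hX h, smul_smul, neg_mul, Complex.I_mul_I, neg_neg, one_smul]⟩
  refine ⟨fun y hy => (key ⟨y, hy⟩).1, fun a b hab => ?_⟩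
  obtain ⟨ha, hval⟩ := key a
  rw [← hval, LinearPMap.smul_apply]
  congr 1
  show genOp hX ⟨(a : FockL2 σ), ha⟩ = genOp hX ⟨(b : FockL2 σ), b.2⟩
  congr 1
  exact Subtype.ext hab

/-- The Hamiltonian of `t ↦ ν₀(e^{tX})` is symmetric (vendored `LinearPMap.IsSymmetric`). -/
theorem isSymmetric_hamiltonian_fockGroup {X : Matrix σ σ ℂ} (hX : star X = -X) :
    (fockGroup hX).hamiltonian.IsSymmetric :=
  (isSelfAdjoint_hamiltonian_fockGroup hX).isSymmetric_linearPMap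

/-- The Hamiltonian of `t ↦ ν₀(e^{tX})` is a closed operator. -/
theorem isClosed_hamiltonian_fockGroup {X : Matrix σ σ ℂ} (hX : star X = -X) :
    (fockGroup hX).hamiltonian.IsClosed :=
  (isSelfAdjoint_hamiltonian_fockGroup hX).isClosed

end HodgeCM.PerL34.Fock.Hermite

-- port_pkg: scope closed for this part
end
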